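import Mathlib.Analysis.Calculus.MeanValue
import Literature.Analysis.FluidPDE.ClassicalSolution
import Literature.Analysis.FluidPDE.ClassicalSolutionCalculus
import Literature.Analysis.FluidPDE.RapidDecayLemmas
import Literature.Analysis.FluidPDE.EnergyUniqueness
import Literature.Analysis.FluidPDE.BoundedDecayIBP
import HarnessLib

/-!
# Mass-export tools II: evolution of weighted masses of MIX-admissible scalars
  (crux `MixingPayoff`, stmt-NavierStokesRegularity-1422, line `birth`)

Helper file (`--supports stmt-NavierStokesRegularity-1422`, anchor `mexaux_massConserved`) for
`mixingPayoff_massExport` (file `SelfMixingDichotomyMixingPayoffMassExport`). On a window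
`[a, b] × ℝ³` let `θ` be a scalar of the MIX class — jointly `C^∞` (`IsSmoothSpaceTimeOn`),
uniformly rapidly decaying (`HasUniformRapidDecayOn`), solving `∂ₜθ + ⟪u, ∇θ⟫ = Δθ` pointwise
with the one-sided time derivative within `[a, b]` — with a drift `u` whose slices are `C¹`,
divergence free and bounded, and let `w ∈ C²(ℝ³)` be bounded with two bounded derivatives.

* `massExport_weightedMass` — the weighted mass `M_w(t) = ∫ θ(t) w` is continuous on `[a, b]`
  and differentiable on `(a, b)` with `M_w'(t) = ∫ θ(t) (Δw + Dw[u(t)])`: differentiation under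
  the integral sign (Mathlib `hasDerivAt_integral_of_dominated_loc_of_deriv_le`, dominated by
  the uniform decay of `θ` and `∂ₜθ`, `RapidDecayLemmas`), the equation, and the whole-space
  integrations by parts of `BoundedDecayIBP` (bounded against decaying):
  `∫ w Δθ = ∫ (Δw) θ` and `∫ (Dw[u] θ + w Dθ[u]) = ∫ div(θ w u) = 0` (`div u = 0`).
* `massExport_weightedMass_sub_eq` — Lagrange form `M_w(t) − M_w(a) = (t − a) M_w'(ξ)`.
* `massExport_mass_conserved`, anchor `mexaux_massConserved` — `w = 1`: the total mass
  `∫ θ(t)` is constant on `[a, b]`.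

Everything is proved (standard axioms); no definitions, no named facts. Reference:
A. J. Majda, A. L. Bertozzi, *Vorticity and Incompressible Flow* (CUP 2002), §3.1.1, p. 87
(whole-space integrations by parts, boundary terms killed by decay).
-/

noncomputable section

open Literature.Analysis.FluidPDE MeasureTheory Set Function Metric Filter Topology
open scoped ContDiff InnerProductSpace Laplacian

-- `Summit = Problem` for this summit; the tree lakefile sets `weak.linter.dupNamespace = false`,
-- made explicit here for out-of-tree `lean check`.
set_option linter.dupNamespace false

namespace Summit.NavierStokesRegularity.NavierStokesRegularity.Theorems

local notation "E3" => EuclideanSpace ℝ (Fin 3)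

/-! ### Two pointwise identities -/

/-- The real inner product on `ℝ` is multiplication. -/
theorem massExport_real_inner_eq_mul (a b : ℝ) : ⟪a, b⟫_ℝ = a * b := by
  simp [mul_comm]

/-- `Dθ(x)[v] = ⟪v, ∇θ(x)⟫` (definition of the gradient). -/
theorem massExport_fderiv_apply_eq_inner_gradient {θ : E3 → ℝ} (x v : E3) :
    fderiv ℝ θ x v = ⟪v, gradient θ x⟫_ℝ := by
  rw [gradient, real_inner_comm, InnerProductSpace.toDual_symm_apply]

/-! ### Weighted masses -/

/-- **Evolution of weighted masses.** Let `θ` be jointly smooth on `[a, b] × ℝ³` (`a < b`) with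
uniform rapid decay and solve `∂ₜθ + ⟪u, ∇θ⟫ = Δθ` pointwise (one-sided time derivative within
`[a, b]`), where every slice `u(t)`, `t ∈ [a, b]`, is `C¹`, divergence free and bounded by `Mu`;
let `w ∈ C²(ℝ³)` with `w`, `Dw`, `D²w` bounded by `Mw`. Then the weighted mass
`M_w(t) = ∫ θ(t, x) w(x) dx` is continuous on `[a, b]`, the slices `θ(t)` and the production
`θ(t) (Δw + Dw[u(t)])` are integrable, and `M_w` is differentiable on `(a, b)` with
`M_w'(t) = ∫ θ(t) (Δw + Dw[u(t)])`. Proof: differentiation under the integral sign (dominated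
by the uniform decay of `θ`, `∂ₜθ`), the equation, and the whole-space integrations by parts
`∫ w Δθ = ∫ Δw θ` (`integral_inner_laplacian_comm_of_bdd_of_decay`) and
`∫ (Dw[u] θ + w Dθ[u]) = 0` (`integral_inner_fderiv_apply_add_eq_zero_of_bdd_of_decay`,
`div u = 0`), bounded against decaying (Majda–Bertozzi, §3.1.1). -/
theorem massExport_weightedMass {a b : ℝ} (hab : a < b) {θ : ℝ → E3 → ℝ}
    {u : ℝ → E3 → E3} {w : E3 → ℝ} {Mu Mw : ℝ}
    (hsm : IsSmoothSpaceTimeOn (Icc a b) θ) (hd : HasUniformRapidDecayOn (Icc a b) θ)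
    (hpde : ∀ t ∈ Icc a b, ∀ x : E3,
      timeDerivWithin (Icc a b) θ t x + ⟪u t x, gradient (θ t) x⟫_ℝ = (Δ (θ t)) x)
    (hu1 : ∀ t ∈ Icc a b, ContDiff ℝ 1 (u t))
    (hdiv : ∀ t ∈ Icc a b, VectorCalculus.IsDivFree (u t))
    (hub : ∀ t ∈ Icc a b, ∀ x, ‖u t x‖ ≤ Mu)
    (hw : ContDiff ℝ 2 w) (hw0 : ∀ x, ‖w x‖ ≤ Mw) (hw1 : ∀ x, ‖fderiv ℝ w x‖ ≤ Mw)
    (hw2 : ∀ x, ‖fderiv ℝ (fderiv ℝ w) x‖ ≤ Mw) :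
    ContinuousOn (fun s => ∫ x, θ s x * w x) (Icc a b) ∧
    (∀ t ∈ Icc a b, Integrable (fun x => θ t x)) ∧
    (∀ t ∈ Icc a b, Integrable (fun x => θ t x * ((Δ w) x + fderiv ℝ w x (u t x)))) ∧
    ∀ t ∈ Ioo a b, HasDerivAt (fun s => ∫ x, θ s x * w x)
      (∫ x, θ t x * ((Δ w) x + fderiv ℝ w x (u t x))) t := by
  set S : Set ℝ := Icc a b with hS_def
  have hS : UniqueDiffOn ℝ S := uniqueDiffOn_Icc hab
  have haS : a ∈ S := ⟨le_rfl, hab.le⟩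
  have hr : (Module.finrank ℝ E3 : ℝ) < 4 := by rw [finrank_euclideanSpace_fin]; norm_num
  -- decay constants (weight exponent 4 > 3 = dim), merged into one constant `C`
  obtain ⟨A0, hA0, hA0b⟩ := hd.norm_le_rpow 4
  obtain ⟨A1, hA1, hA1b⟩ := hd.norm_fderiv_le_rpow hsm hS 4
  obtain ⟨A2, hA2, hA2b⟩ := hd.norm_fderiv_fderiv_le_rpow hsm hS 4
  obtain ⟨A3, hA3, hA3b⟩ := hd.norm_timeDerivWithin_le_rpow hsm hS 4
  have e4 : ((4 : ℕ) : ℝ) = 4 := by norm_num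
  rw [e4] at hA0b hA1b hA2b hA3b
  set C : ℝ := A0 + A1 + A2 + A3 with hC_def
  have hC : 0 ≤ C := by rw [hC_def]; positivity
  have h0 : ∀ s ∈ S, ∀ x, ‖θ s x‖ ≤ C * (1 + ‖x‖) ^ (-(4 : ℝ)) := fun s hs x =>
    le_decay_of_le_decay x (hA0b s hs x) (by rw [hC_def]; linarith)
  have h1 : ∀ s ∈ S, ∀ x, ‖fderiv ℝ (θ s) x‖ ≤ C * (1 + ‖x‖) ^ (-(4 : ℝ)) := fun s hs x =>
    le_decay_of_le_decay x (hA1b s hs x) (by rw [hC_def]; linarith)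
  have h2 : ∀ s ∈ S, ∀ x, ‖fderiv ℝ (fderiv ℝ (θ s)) x‖ ≤ C * (1 + ‖x‖) ^ (-(4 : ℝ)) :=
    fun s hs x => le_decay_of_le_decay x (hA2b s hs x) (by rw [hC_def]; linarith)
  have h3 : ∀ s ∈ S, ∀ x, ‖timeDerivWithin S θ s x‖ ≤ C * (1 + ‖x‖) ^ (-(4 : ℝ)) :=
    fun s hs x => le_decay_of_le_decay x (hA3b s hs x) (by rw [hC_def]; linarith)
  -- continuity and signs
  have hθc : ∀ s ∈ S, Continuous (θ s) := fun s hs => hsm.continuous_slice hs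
  have hDθc : ∀ s ∈ S, Continuous (fderiv ℝ (θ s)) := fun s hs => hsm.continuous_fderiv_slice hs
  have hθtc : ∀ s ∈ S, Continuous (timeDerivWithin S θ s) := fun s hs =>
    hsm.continuous_timeDerivWithin hS hs
  have hwc : Continuous w := hw.continuous
  have hDwc : Continuous (fderiv ℝ w) := hw.continuous_fderiv two_ne_zero
  have hΔwc : Continuous (Δ w) := continuous_laplacian hw
  have huc : ∀ s ∈ S, Continuous (u s) := fun s hs => (hu1 s hs).continuous
  have hMu : 0 ≤ Mu := (norm_nonneg _).trans (hub a haS 0)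
  have hMw : 0 ≤ Mw := (norm_nonneg _).trans (hw0 0)
  have hΔwb : ∀ x, ‖(Δ w) x‖ ≤ 3 * Mw := fun x => by
    have := norm_laplacian_le w x
    rw [finrank_euclideanSpace_fin] at this
    push_cast at this
    exact this.trans (by gcongr; exact hw2 x)
  have hweight : Integrable (fun x : E3 => (1 + ‖x‖) ^ (-(4 : ℝ))) (volume : Measure E3) :=
    integrable_one_add_norm hr
  -- integrability of the slices and of the weighted slices
  have hIθ : ∀ s ∈ S, Integrable (fun x => θ s x) (volume : Measure E3) := fun s hs =>
    integrable_of_norm_le_rpow_neg (hθc s hs) hr (h0 s hs)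
  have hIθw : ∀ s ∈ S, Integrable (fun x => θ s x * w x) (volume : Measure E3) := fun s hs =>
    integrable_of_norm_le_const_mul_decay ((hθc s hs).mul hwc) hr (C₁ := Mw) (C₂ := C)
      fun x => by
        rw [norm_mul, mul_comm]
        exact mul_le_mul (hw0 x) (h0 s hs x) (norm_nonneg _) hMw
  -- the production term is integrable
  have hIG : ∀ s ∈ S, Integrable (fun x => θ s x * ((Δ w) x + fderiv ℝ w x (u s x)))
      (volume : Measure E3) := by
    intro s hs
    refine integrable_of_norm_le_const_mul_decay (C₁ := 3 * Mw + Mw * Mu) (C₂ := C)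
      ((hθc s hs).mul (hΔwc.add (hDwc.clm_apply (huc s hs)))) hr fun x => ?_
    rw [norm_mul, mul_comm]
    refine mul_le_mul ?_ (h0 s hs x) (norm_nonneg _) (by positivity)
    refine (norm_add_le _ _).trans (add_le_add (hΔwb x) ?_)
    exact (ContinuousLinearMap.le_opNorm _ _).trans
      (mul_le_mul (hw1 x) (hub s hs x) (norm_nonneg _) hMw)
  refine ⟨?_, hIθ, hIG, ?_⟩
  · -- continuity of the weighted mass on `[a, b]` (dominated convergence)
    refine continuousOn_of_dominated (bound := fun x => Mw * (C * (1 + ‖x‖) ^ (-(4 : ℝ))))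
      (fun s hs => ((hθc s hs).mul hwc).aestronglyMeasurable) (fun s hs => ?_)
      ((hweight.const_mul C).const_mul Mw) ?_
    · refine Eventually.of_forall fun x => ?_
      rw [norm_mul, mul_comm]
      exact mul_le_mul (hw0 x) (h0 s hs x) (norm_nonneg _) hMw
    · refine Eventually.of_forall fun x => ?_
      exact (hsm.continuousOn_time x).mul continuousOn_const
  · -- differentiability on `(a, b)`
    intro t ht
    have htS : t ∈ S := Ioo_subset_Icc_self ht
    have hIoo : Ioo a b ∈ 𝓝 t := Ioo_mem_nhds ht.1 ht.2
    -- (i) differentiation under the integral sign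
    have key := hasDerivAt_integral_of_dominated_loc_of_deriv_le (μ := (volume : Measure E3))
      (F := fun σ x => θ σ x * w x) (F' := fun σ x => timeDerivWithin S θ σ x * w x) (x₀ := t)
      (s := Ioo a b) (bound := fun x => Mw * (C * (1 + ‖x‖) ^ (-(4 : ℝ)))) hIoo ?_ (hIθw t htS)
      ?_ ?_ ((hweight.const_mul C).const_mul Mw) ?_
    rotate_left
    · filter_upwards [hIoo] with σ hσ
      exact ((hθc σ (Ioo_subset_Icc_self hσ)).mul hwc).aestronglyMeasurable
    · exact ((hθtc t htS).mul hwc).aestronglyMeasurable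
    · refine Eventually.of_forall fun x σ hσ => ?_
      rw [norm_mul, mul_comm]
      exact mul_le_mul (hw0 x) (h3 σ (Ioo_subset_Icc_self hσ) x) (norm_nonneg _) hMw
    · refine Eventually.of_forall fun x σ hσ => ?_
      have hσS : σ ∈ S := Ioo_subset_Icc_self hσ
      have hSσ : S ∈ 𝓝 σ := mem_of_superset (Ioo_mem_nhds hσ.1 hσ.2) Ioo_subset_Icc_self
      exact ((hsm.hasDerivWithinAt_timeDerivWithin hS hσS x).hasDerivAt hSσ).mul_const (w x)
    obtain ⟨hIP, hderiv⟩ := key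
    -- (ii) the value of the derivative: insert the equation and integrate by parts
    have hθ2 : ContDiff ℝ 2 (θ t) := contDiff_infty.1 (hsm.contDiff_slice htS) 2
    have hθ1 : ContDiff ℝ 1 (θ t) := contDiff_infty.1 (hsm.contDiff_slice htS) 1
    have hw1' : ContDiff ℝ 1 w := hw.of_le one_le_two
    -- Green: `∫ Δw θ = ∫ w Δθ`
    have hGreen := integral_inner_laplacian_comm_of_bdd_of_decay (F' := ℝ) hw hθ2 hr hw0 hw1 hw2
      (h0 t htS) (h1 t htS) (h2 t htS)
    -- transport: `∫ (Dw[u] θ + w Dθ[u]) = 0`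
    have hTrans := integral_inner_fderiv_apply_add_eq_zero_of_bdd_of_decay (F' := ℝ) (hu1 t htS)
      hw1' hθ1 (hdiv t htS) hr (M := max Mu Mw)
      (fun x => (hub t htS x).trans (le_max_left _ _)) (fun x => (hw0 x).trans (le_max_right _ _))
      (fun x => (hw1 x).trans (le_max_right _ _)) (h0 t htS) (h1 t htS)
    simp only [massExport_real_inner_eq_mul] at hGreen hTrans
    -- integrability of the four pairings
    have hB1 : Integrable (fun x => fderiv ℝ w x (u t x) * θ t x) (volume : Measure E3) := by
      refine integrable_of_norm_le_const_mul_decay (C₁ := Mw * Mu) (C₂ := C)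
        ((hDwc.clm_apply (huc t htS)).mul (hθc t htS)) hr fun x => ?_
      rw [norm_mul]
      refine mul_le_mul ?_ (h0 t htS x) (norm_nonneg _) (by positivity)
      exact (ContinuousLinearMap.le_opNorm _ _).trans
        (mul_le_mul (hw1 x) (hub t htS x) (norm_nonneg _) hMw)
    have hB2 : Integrable (fun x => w x * fderiv ℝ (θ t) x (u t x)) (volume : Measure E3) := by
      refine integrable_of_norm_le_const_mul_decay (C₁ := Mw * Mu) (C₂ := C)
        (hwc.mul ((hDθc t htS).clm_apply (huc t htS))) hr fun x => ?_
      rw [norm_mul]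
      calc ‖w x‖ * ‖fderiv ℝ (θ t) x (u t x)‖ ≤ Mw * (‖fderiv ℝ (θ t) x‖ * ‖u t x‖) :=
            mul_le_mul (hw0 x) (ContinuousLinearMap.le_opNorm _ _) (norm_nonneg _) hMw
        _ ≤ Mw * (C * (1 + ‖x‖) ^ (-(4 : ℝ)) * Mu) :=
            mul_le_mul_of_nonneg_left (mul_le_mul (h1 t htS x) (hub t htS x) (norm_nonneg _)
              ((norm_nonneg _).trans (h1 t htS x))) hMw
        _ = Mw * Mu * (C * (1 + ‖x‖) ^ (-(4 : ℝ))) := by ring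
    have hA2 : Integrable (fun x => θ t x * (Δ w) x) (volume : Measure E3) := by
      refine integrable_of_norm_le_const_mul_decay (C₁ := 3 * Mw) (C₂ := C)
        ((hθc t htS).mul hΔwc) hr fun x => ?_
      rw [norm_mul, mul_comm]
      exact mul_le_mul (hΔwb x) (h0 t htS x) (norm_nonneg _) (by positivity)
    -- pointwise form of the equation
    have hP : ∀ x, timeDerivWithin S θ t x * w x =
        w x * (Δ (θ t)) x - w x * fderiv ℝ (θ t) x (u t x) := fun x => by
      rw [← hpde t htS x, massExport_fderiv_apply_eq_inner_gradient]
      ring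
    have hA1 : Integrable (fun x => w x * (Δ (θ t)) x) (volume : Measure E3) := by
      have : (fun x => w x * (Δ (θ t)) x) =
          fun x => timeDerivWithin S θ t x * w x + w x * fderiv ℝ (θ t) x (u t x) := by
        funext x; rw [hP x]; ring
      rw [this]
      exact hIP.add hB2
    have hval : ∫ x, timeDerivWithin S θ t x * w x =
        ∫ x, θ t x * ((Δ w) x + fderiv ℝ w x (u t x)) := by
      have e1 : ∫ x, timeDerivWithin S θ t x * w x =
          (∫ x, w x * (Δ (θ t)) x) - ∫ x, w x * fderiv ℝ (θ t) x (u t x) := by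
        rw [← integral_sub hA1 hB2]
        exact integral_congr_ae (Eventually.of_forall hP)
      have e2 : ∫ x, w x * fderiv ℝ (θ t) x (u t x) = -∫ x, fderiv ℝ w x (u t x) * θ t x := by
        rw [integral_add hB1 hB2] at hTrans
        linarith
      have e3 : ∫ x, θ t x * ((Δ w) x + fderiv ℝ w x (u t x)) =
          (∫ x, θ t x * (Δ w) x) + ∫ x, fderiv ℝ w x (u t x) * θ t x := by
        rw [← integral_add hA2 hB1]
        exact integral_congr_ae (Eventually.of_forall fun x => by ring)
      have e4 : ∫ x, θ t x * (Δ w) x = ∫ x, (Δ w) x * θ t x :=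
        integral_congr_ae (Eventually.of_forall fun x => mul_comm _ _)
      rw [e1, e2, e3, e4, hGreen]
      ring
    rw [← hval]
    exact hderiv

/-- **Lagrange form of the weighted-mass evolution.** In the setting of
`massExport_weightedMass`, for `a < t ≤ b` there is `ξ ∈ (a, t)` with
`∫ θ(t) w − ∫ θ(a) w = (t − a) · ∫ θ(ξ) (Δw + Dw[u(ξ)])` (mean value theorem). -/
theorem massExport_weightedMass_sub_eq {a b : ℝ} (hab : a < b) {θ : ℝ → E3 → ℝ}
    {u : ℝ → E3 → E3} {w : E3 → ℝ} {Mu Mw : ℝ}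
    (hsm : IsSmoothSpaceTimeOn (Icc a b) θ) (hd : HasUniformRapidDecayOn (Icc a b) θ)
    (hpde : ∀ t ∈ Icc a b, ∀ x : E3,
      timeDerivWithin (Icc a b) θ t x + ⟪u t x, gradient (θ t) x⟫_ℝ = (Δ (θ t)) x)
    (hu1 : ∀ t ∈ Icc a b, ContDiff ℝ 1 (u t))
    (hdiv : ∀ t ∈ Icc a b, VectorCalculus.IsDivFree (u t))
    (hub : ∀ t ∈ Icc a b, ∀ x, ‖u t x‖ ≤ Mu)
    (hw : ContDiff ℝ 2 w) (hw0 : ∀ x, ‖w x‖ ≤ Mw) (hw1 : ∀ x, ‖fderiv ℝ w x‖ ≤ Mw)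
    (hw2 : ∀ x, ‖fderiv ℝ (fderiv ℝ w) x‖ ≤ Mw) {t : ℝ} (ht : t ∈ Ioc a b) :
    ∃ ξ ∈ Ioo a t, (∫ x, θ t x * w x) - (∫ x, θ a x * w x) =
      (t - a) * ∫ x, θ ξ x * ((Δ w) x + fderiv ℝ w x (u ξ x)) := by
  obtain ⟨hcont, -, -, hderiv⟩ := massExport_weightedMass hab hsm hd hpde hu1 hdiv hub hw hw0 hw1 hw2
  obtain ⟨ξ, hξ, he⟩ := exists_hasDerivAt_eq_slope (fun s => ∫ x, θ s x * w x)
    (fun s => ∫ x, θ s x * ((Δ w) x + fderiv ℝ w x (u s x))) ht.1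
    (hcont.mono (Icc_subset_Icc_right ht.2)) fun s hs => hderiv s ⟨hs.1, hs.2.trans_le ht.2⟩
  refine ⟨ξ, hξ, ?_⟩
  have hta : t - a ≠ 0 := sub_ne_zero.2 ht.1.ne'
  rw [he, mul_div_cancel₀ _ hta]

/-- **Conservation of mass.** In the setting of `massExport_weightedMass` (weight `w = 1`):
`∫ θ(t) = ∫ θ(a)` for `t ∈ [a, b]`, since `Δ1 = 0` and `D1 = 0`. -/
theorem massExport_mass_conserved {a b : ℝ} (hab : a < b) {θ : ℝ → E3 → ℝ}
    {u : ℝ → E3 → E3} {Mu : ℝ}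
    (hsm : IsSmoothSpaceTimeOn (Icc a b) θ) (hd : HasUniformRapidDecayOn (Icc a b) θ)
    (hpde : ∀ t ∈ Icc a b, ∀ x : E3,
      timeDerivWithin (Icc a b) θ t x + ⟪u t x, gradient (θ t) x⟫_ℝ = (Δ (θ t)) x)
    (hu1 : ∀ t ∈ Icc a b, ContDiff ℝ 1 (u t))
    (hdiv : ∀ t ∈ Icc a b, VectorCalculus.IsDivFree (u t))
    (hub : ∀ t ∈ Icc a b, ∀ x, ‖u t x‖ ≤ Mu) :
    ∀ t ∈ Icc a b, ∫ x, θ t x = ∫ x, θ a x := by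
  intro t ht
  rcases eq_or_lt_of_le ht.1 with h | hat
  · rw [h]
  obtain ⟨ξ, -, he⟩ := massExport_weightedMass_sub_eq hab hsm hd hpde hu1 hdiv hub
    (w := fun _ => (1 : ℝ)) (Mw := 1) contDiff_const (fun x => by simp) (fun x => by simp)
    (fun x => by simp [ContinuousLinearMap.opNorm_zero]) ⟨hat, ht.2⟩
  have h0 : ∀ x : E3, (Δ (fun _ : E3 => (1 : ℝ))) x + fderiv ℝ (fun _ : E3 => (1 : ℝ)) x (u ξ x) = 0 :=
    fun x => by simp
  simp only [mul_one, h0, mul_zero, integral_zero] at he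
  linarith

/-- **Anchor `mexaux_massConserved` — conservation of mass for MIX-admissible scalars** (the
closed form of `massExport_mass_conserved`, registered on the crux item): for `θ` jointly smooth
on `[a, b] × ℝ³` with uniform rapid decay solving `∂ₜθ + ⟪u, ∇θ⟫ = Δθ` with a drift whose slices
are `C¹`, divergence free and bounded, `∫ θ(t) = ∫ θ(a)` for all `t ∈ [a, b]`. -/
theorem mexaux_massConserved :
    ∀ (a b : ℝ), a < b → ∀ (θ : ℝ → E3 → ℝ) (u : ℝ → E3 → E3) (Mu : ℝ),
    IsSmoothSpaceTimeOn (Set.Icc a b) θ → HasUniformRapidDecayOn (Set.Icc a b) θ →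
    (∀ t ∈ Set.Icc a b, ∀ x : E3,
      timeDerivWithin (Set.Icc a b) θ t x + inner ℝ (u t x) (gradient (θ t) x)
        = Laplacian.laplacian (θ t) x) →
    (∀ t ∈ Set.Icc a b, ContDiff ℝ 1 (u t)) →
    (∀ t ∈ Set.Icc a b, VectorCalculus.IsDivFree (u t)) →
    (∀ t ∈ Set.Icc a b, ∀ x : E3, ‖u t x‖ ≤ Mu) →
    ∀ t ∈ Set.Icc a b, ∫ x, θ t x = ∫ x, θ a x :=
  fun _ _ hab _ _ _ hsm hd hpde hu1 hdiv hub =>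
    massExport_mass_conserved hab hsm hd hpde hu1 hdiv hub

end Summit.NavierStokesRegularity.NavierStokesRegularity.Theorems

end
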